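import Summits.ResolutionOfSingularities.ResolutionOfSingularities.Theses.HomologicalConductor
import Summits.ResolutionOfSingularities.ResolutionOfSingularities.Theses.Valuative
import Summits.ResolutionOfSingularities.ResolutionOfSingularities.Theses.CyclicCovers
import Summits.ResolutionOfSingularities.ResolutionOfSingularities.Theorems.HomologicalConductorGlobalisation
import Summits.ResolutionOfSingularities.ResolutionOfSingularities.Theorems.ValuativePatchingReductions
import HarnessLib

/-!
# Crux `HomologicalConductor.Globalisation` (stmt-ResolutionOfSingularities-16486): inter-route edges —
# the crux is implied by route Valuative's `PatchingRel` (stmt-0642) and `Patching` (stmt-0561)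

Route `ResolutionOfSingularities/HomologicalConductor`, crux #5 `Globalisation` =
`∀ p prime, VT_p → ResolutionInChar p` (`VT_p` = valuative termination of the canonical normalised
ca-tower, the conclusion of crux `NoZeno` at `p`). The landed assembly
(`HomologicalConductorGlobalisation.lean`) proves `lurel_of_valuativeTermination : VT_p → LUrel_p`,
whose conclusion is VERBATIM the antecedent of route Valuative's crux
`PatchingRel := ∀ p prime, LUrel_p → ResolutionInChar p` (stmt-ResolutionOfSingularities-0642).
Hence:

* `globalisation_of_patchingRel` — **`Valuative.PatchingRel → Globalisation`** (edge 0642 ⇒ 16486):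
  the crux's residual content, beyond its landed local-uniformization half, is at most Zariski's
  patching problem "relative LU ⇒ resolution" (open in dimension `≥ 4`, Piltant 2013, p. 2).
* `globalisation_of_patching`, `globalisation_of_cyclicCoversPatching` — the ABSOLUTE patching item
  `Patching` (stmt-0561, shared by routes Valuative / CyclicCovers) implies the crux as well
  (`patchingRel_of_patching`).
* `globalisation_of_nagata_of_sandwiched` — through `patching_of_nagata_of_sandwiched`
  (`ValuativePatchingReductions.lean`): Nagata compactification + strong resolution of sandwiched
  schemes in every prime characteristic (`SandwichedStrongResolution`, Cossart–Piltant 2019 shape,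
  open in dimension `≥ 4`) imply the crux.
* `globalisation_iff_patchingRel_of_valuativeTermination` — under the crux's own antecedent at
  every prime the crux and `PatchingRel` coincide (both say `∀ p prime, ResolutionInChar p`);
  unconditionally `ResolutionOfSingularities → Patching → PatchingRel → Globalisation`
  (`patching_of_resolutionOfSingularities`, `patchingRel_of_patching`, `globalisation_of_patchingRel`),
  the crux being the WEAKEST of the four (its antecedent `VT_p` is stronger than `LUrel_p`).

## References

* O. Zariski, Ann. of Math. 45 (1944) 472–542, Fundamental Theorem p. 539.
* O. Piltant, *An axiomatic version of Zariski's patching theorem*, RACSAM 107 (2013) 91–121,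
  p. 2, Prop. 5.1, Cor. 5.7. [Piltant2013]
-/

noncomputable section

-- single-problem summit: the doubled namespace component `ResolutionOfSingularities` is forced
set_option linter.dupNamespace false

namespace Summit.ResolutionOfSingularities.ResolutionOfSingularities.Theorems.HomologicalConductorGlobalisation

open Literature.AlgebraicGeometry Literature.AlgebraicGeometry.Resolution
open Literature.AlgebraicGeometry.Morphisms
open Summit.ResolutionOfSingularities.ResolutionOfSingularities.Theses
open Summit.ResolutionOfSingularities.ResolutionOfSingularities.Theses.HomologicalConductor (Globalisation)

/-- **Inter-route edge 0642 ⇒ 16486.** Route Valuative's crux `PatchingRel`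
(`∀ p prime, LUrel_p → ResolutionInChar p`) implies the crux `Globalisation` of route
HomologicalConductor: the antecedent `VT_p` of the latter is a relative local uniformization theorem
(`lurel_of_valuativeTermination`, landed), whose output is verbatim `LUrel_p`.
[cite: Piltant2013, Cor. 5.7] -/
theorem globalisation_of_patchingRel (h : Valuative.PatchingRel) : Globalisation :=
  fun p hp hVT => h p hp (lurel_of_valuativeTermination p hVT)

/-- **Edge 0561 ⇒ 16486.** The absolute patching item `Patching` of route Valuative
(`∀ p prime, LU_p → ResolutionInChar p`, stmt-0561) implies the crux (through
`patchingRel_of_patching`: the absolute item is the stronger implication). [folklore] -/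
theorem globalisation_of_patching (h : Valuative.Patching) : Globalisation :=
  globalisation_of_patchingRel (patchingRel_of_patching h)

/-- The same edge from the `CyclicCovers` copy of the patching item (the same term,
`cyclicCovers_patching_iff`). [folklore] -/
theorem globalisation_of_cyclicCoversPatching (h : CyclicCovers.Patching) : Globalisation :=
  globalisation_of_patching (cyclicCovers_patching_iff.mp h)

/-- **The crux modulo the atom of Zariski's patching programme.** Nagata compactification of
separated finite-type `k`-schemes together with strong (iso over `Reg`) resolution of schemes proper
and birational over a regular variety, in every prime characteristic (`SandwichedStrongResolution`,
the Cossart–Piltant 2019 shape; OPEN in dimension `≥ 4`), imply the crux — via the landed chain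
`patching_of_nagata_of_sandwiched` of route Valuative's patching items. A CONDITIONAL result: both
hypotheses are conjecture-type named statements, not theorems of the tree.
[cite: Piltant2013, Prop. 5.1 (proof, Steps 2-5) and Cor. 5.7] -/
theorem globalisation_of_nagata_of_sandwiched (hN : NagataCompactification.{0})
    (hS : ∀ p : ℕ, p.Prime → SandwichedStrongResolution.{0} p) : Globalisation :=
  globalisation_of_patching (patching_of_nagata_of_sandwiched hN hS)

/-- Under its own antecedent at every prime (valuative termination of the canonical ca-tower in
every prime characteristic) the crux `Globalisation` and route Valuative's `PatchingRel` are the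
SAME statement: both then say `∀ p prime, ResolutionInChar p` (the crux directly; `PatchingRel`
because `VT_p` supplies its antecedent `LUrel_p`, `lurel_of_valuativeTermination`). Unconditionally
only `PatchingRel → Globalisation` holds (`globalisation_of_patchingRel`): the crux's antecedent
`VT_p` is the STRONGER local statement, so the crux is the weaker implication. [folklore] -/
theorem globalisation_iff_patchingRel_of_valuativeTermination
    (hVT : ∀ p : ℕ, p.Prime → ∀ (k K : Type) [Field k] [CharP k p] [Field K] [Algebra k K] (O : ValuationSubring K) (A : Subalgebra k K), (∀ c : k, algebraMap k K c ∈ O) → A.FG → IsFractionRing ↥A K → A.toSubring ≤ O.toSubring → let ca : Subalgebra k K → Set K := fun A => {x : K | ∃ hx : x ∈ A, ∃ n : ℕ, ∀ i : ℕ, n ≤ i → ∀ (M N : ModuleCat.{0} ↥A), Module.Finite ↥A M → Module.Finite ↥A N → ∀ e : CategoryTheory.Abelian.Ext.{0} M N i, (⟨x, hx⟩ : ↥A) • e = 0}; let loc : Subalgebra k K → Subalgebra k K := fun A => Algebra.adjoin k {y : K | ∃ a ∈ A, ∃ s ∈ A, s⁻¹ ∈ O ∧ y = a * s⁻¹}; let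 chart : Subalgebra k K → Subalgebra k K := fun A => Algebra.adjoin k ((A : Set K) ∪ {y : K | ∃ c ∈ ca A, ∃ x ∈ ca A, x ≠ 0 ∧ (∀ c' ∈ ca A, c' * x⁻¹ ∈ O) ∧ y = c * x⁻¹}); let nrm : Subalgebra k K → Subalgebra k K := fun B => Algebra.adjoin k {y : K | IsIntegral ↥B y}; let tower : Subalgebra k K → ℕ → Subalgebra k K := fun A m => @Nat.rec (fun _ => Subalgebra k K) (loc A) (fun _ B => loc (nrm (chart B))) m; ∃ m : ℕ, IsRegularLocalRing ↥(tower A m)) :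
    Globalisation ↔ Valuative.PatchingRel :=
  ⟨fun hG p hp _ => hG p hp (hVT p hp), globalisation_of_patchingRel⟩

end Summit.ResolutionOfSingularities.ResolutionOfSingularities.Theorems.HomologicalConductorGlobalisation

end
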